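import Mathlib
import HarnessLib

/-!
# LAYER-α lemma for the crux `SignedTransportAtTwo` (stmt-BirchSwinnertonDyer-20333, route `ThetaPartnerAtTwo`, line
# `bridge`, stub `stub_V2mt`): the UN-HALVED plus part of a rank-2 module with a residually non-trivial involution
# over a local ring of residue characteristic 2 is free of rank one
# (lead prover bsd-wall-tp2-p1 g2, on the planner's hand-off PRESEARCH-TP2-AT2-v1.2 §6.2 / LayerAlpha_sketch.lean;
# `--supports stmt-BirchSwinnertonDyer-20333`; route-independent commutative algebra; closes nothing)

HONEST FRAMING. Pure commutative algebra (Mathlib only); nothing about any curve or Hecke algebra is asserted.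

WHY. Vatsal's proof of the congruence formula (Duke 98 (1999) Thm. (1.10)) — the printed shape of the analytic stub
`stub_V2mt` of the crux — decomposes `H¹(X₀(N), ℤ_p)_𝔪 = H⁺ ⊕ H⁻` under the archimedean involution `c` using `p` odd
(the projectors `(1 ± c)/2`). At `p = 2` the planner of record observed (PRESEARCH-TP2-AT2-v1.2 §6.2) that on the theta
habitat (`Δ_E < 0`, so complex conjugation is a transposition on `E[2]`, i.e. `c̄ ≠ 1`) no halving is needed: THIS LEMMA.
If `R` is local with `2 ∈ 𝔪_R`, `M` is `R`-free of rank `2`, `c` an `R`-linear involution of `M` with `c m₀ − m₀ ∉ 𝔪M`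
for some `m₀`, then with `e := m₀`: `{e, c e}` is a basis of `M` (so `M ≅ R[C₂]` is free of rank one over the group ring),
the fixed module `M^{c=1}` is `R·(e + c e)`, free of rank one. Proof (elementary, no residue field): the `2 × 2`
determinant of `(e, c e)` in any basis is a unit — otherwise a unimodular relation `α e + β c e ∈ 𝔪M` exists, and applying
`c`, adding and subtracting (with `2 ∈ 𝔪`) forces `c e − e ∈ 𝔪M`; then Cramer's rule. No sorry; standard axioms.

References: [Vatsal1999] §1 (canonical periods; Thm. (1.10)); [KilfordWiese2008] Thm. 1.2 (multiplicity one mod 2 for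
`ρ̄` ramified at 2 — why `H_𝔪` is free of rank 2 on the habitat); [Matsumura1986] Thm. 2.2 (Nakayama).
-/

set_option autoImplicit false
-- D-0017: single-problem summit, so `Summit.BirchSwinnertonDyer.BirchSwinnertonDyer.…` repeats a namespace BY DESIGN.
set_option linter.dupNamespace false

noncomputable section

open scoped Classical

namespace Summit.BirchSwinnertonDyer.BirchSwinnertonDyer.Theorems.SignedTransportAtTwo

section LayerAlpha

variable {R : Type*} [CommRing R] [IsLocalRing R] {M : Type*} [AddCommGroup M] [Module R M]

/-- Coordinates in the maximal ideal put a vector in `𝔪M`: if both coordinates of `x` in a basis `b` of `Fin 2` lie in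
`𝔪` then `x ∈ 𝔪 • M`. [folklore] -/
theorem mem_maximalIdeal_smul_top_of_coord (b : Module.Basis (Fin 2) R M) {x : M}
    (h0 : b.repr x 0 ∈ IsLocalRing.maximalIdeal R) (h1 : b.repr x 1 ∈ IsLocalRing.maximalIdeal R) :
    x ∈ (IsLocalRing.maximalIdeal R • ⊤ : Submodule R M) := by
  rw [← b.sum_repr x, Fin.sum_univ_two]
  exact Submodule.add_mem _ (Submodule.smul_mem_smul h0 Submodule.mem_top) (Submodule.smul_mem_smul h1 Submodule.mem_top)

/-- **The `2 × 2` determinant of `(e, c e)` is a unit** when `c` is an involution with `c e − e ∉ 𝔪M` and `2 ∈ 𝔪`.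
[cite: Vatsal1999, §1 (the decomposition under the archimedean involution)] -/
theorem isUnit_det_of_involution (h2 : (2 : R) ∈ IsLocalRing.maximalIdeal R) (b : Module.Basis (Fin 2) R M)
    (c : M →ₗ[R] M) (hc : c ∘ₗ c = LinearMap.id) {e : M}
    (he : c e - e ∉ (IsLocalRing.maximalIdeal R • ⊤ : Submodule R M)) :
    IsUnit (b.repr e 0 * b.repr (c e) 1 - b.repr e 1 * b.repr (c e) 0) := by
  set 𝔪 := IsLocalRing.maximalIdeal R with h𝔪
  set N := (𝔪 • ⊤ : Submodule R M) with hN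
  set w := c e with hw
  have hcw : c w = e := by
    have := LinearMap.congr_fun hc e
    simpa using this
  -- `c` preserves `𝔪M`
  have hcN : ∀ x ∈ N, c x ∈ N := by
    intro x hx
    have : N.map c ≤ N := by
      rw [hN, Submodule.map_smul'']
      exact Submodule.smul_mono le_rfl le_top
    exact this ⟨x, hx, rfl⟩
  -- KEY: a relation `α e + β w ∈ 𝔪M` with `α` or `β` a unit forces `w − e ∈ 𝔪M`
  have key : ∀ α β : R, α • e + β • w ∈ N → (α ∉ 𝔪 ∨ β ∉ 𝔪) → False := by
    intro α β hrel hunit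
    apply he
    have hrel' : α • w + β • e ∈ N := by
      have := hcN _ hrel
      rwa [map_add, map_smul, map_smul, hcw] at this
    -- `(α + β)(e + w) ∈ 𝔪M` and `(α − β)(w − e) ∈ 𝔪M`
    have hsum : (α + β) • (e + w) ∈ N := by
      have := N.add_mem hrel hrel'
      convert this using 1
      simp only [add_smul, smul_add]; abel
    have hdiff : (α - β) • (w - e) ∈ N := by
      have := N.sub_mem hrel' hrel
      convert this using 1
      simp only [sub_smul, smul_sub]; abel
    by_cases hαβ : α - β ∈ 𝔪
    · -- then `α + β = (α − β) + 2β ∈ 𝔪`? no: we need a unit. Since `α − β ∈ 𝔪`, `α` and `β` are both units or both not;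
      -- one of them is a unit, so `α` is a unit and `α + β = 2α − (α − β) ∈ 𝔪`… use instead `α(e + w) ∈ 𝔪M`:
      have hα : α ∉ 𝔪 := by
        rcases hunit with hα | hβ
        · exact hα
        · intro hα
          exact hβ (by simpa using 𝔪.sub_mem hα hαβ)
      have hαu : IsUnit α := by
        by_contra h
        exact hα ((IsLocalRing.mem_maximalIdeal α).mpr h)
      -- `α(e + w) = (α e + β w) + (α − β) w`
      have h1 : α • (e + w) ∈ N := by
        have := N.add_mem hrel (Submodule.smul_mem_smul hαβ (Submodule.mem_top : w ∈ (⊤ : Submodule R M)))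
        convert this using 1
        simp only [smul_add, sub_smul]; abel
      have hew : e + w ∈ N := by
        obtain ⟨u, hu⟩ := hαu
        have := N.smul_mem (↑u⁻¹ : R) h1
        rwa [← hu, ← mul_smul, Units.inv_mul, one_smul] at this
      -- `w − e = (e + w) − 2e`
      have h3 : (2 : R) • e ∈ N := Submodule.smul_mem_smul h2 Submodule.mem_top
      have := N.sub_mem hew h3
      convert this using 1
      rw [two_smul]; abel
    · have hu : IsUnit (α - β) := by
        by_contra h
        exact hαβ ((IsLocalRing.mem_maximalIdeal _).mpr h)
      obtain ⟨u, hu'⟩ := hu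
      have := N.smul_mem (↑u⁻¹ : R) hdiff
      rwa [← hu', ← mul_smul, Units.inv_mul, one_smul] at this
  -- if the determinant is not a unit, produce such a relation from the coordinates
  by_contra hdet
  have hdet𝔪 : b.repr e 0 * b.repr w 1 - b.repr e 1 * b.repr w 0 ∈ 𝔪 := (IsLocalRing.mem_maximalIdeal _).mpr hdet
  -- relation 1: `w₁ • e − e₁ • w` has coordinates `(det, 0)`
  have rel1 : b.repr w 1 • e + (-(b.repr e 1)) • w ∈ N := by
    refine mem_maximalIdeal_smul_top_of_coord b ?_ ?_
    · simp only [map_add, map_smul, Finsupp.coe_add, Finsupp.coe_smul, Pi.add_apply, Pi.smul_apply, smul_eq_mul]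
      convert hdet𝔪 using 1; ring
    · simp only [map_add, map_smul, Finsupp.coe_add, Finsupp.coe_smul, Pi.add_apply, Pi.smul_apply, smul_eq_mul]
      convert 𝔪.zero_mem using 1; ring
  -- relation 2: `w₀ • e − e₀ • w` has coordinates `(0, −det)`
  have rel2 : b.repr w 0 • e + (-(b.repr e 0)) • w ∈ N := by
    refine mem_maximalIdeal_smul_top_of_coord b ?_ ?_
    · simp only [map_add, map_smul, Finsupp.coe_add, Finsupp.coe_smul, Pi.add_apply, Pi.smul_apply, smul_eq_mul]
      convert 𝔪.zero_mem using 1; ring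
    · simp only [map_add, map_smul, Finsupp.coe_add, Finsupp.coe_smul, Pi.add_apply, Pi.smul_apply, smul_eq_mul]
      convert 𝔪.neg_mem hdet𝔪 using 1; ring
  -- all four coordinates in `𝔪` would put `w − e` in `𝔪M`
  by_cases h10 : b.repr w 1 ∉ 𝔪 ∨ -(b.repr e 1) ∉ 𝔪
  · exact key _ _ rel1 h10
  by_cases h20 : b.repr w 0 ∉ 𝔪 ∨ -(b.repr e 0) ∉ 𝔪
  · exact key _ _ rel2 h20
  push Not at h10 h20
  apply he
  refine mem_maximalIdeal_smul_top_of_coord b ?_ ?_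
  · rw [map_sub, Finsupp.coe_sub, Pi.sub_apply]
    exact 𝔪.sub_mem h20.1 (by simpa using h20.2)
  · rw [map_sub, Finsupp.coe_sub, Pi.sub_apply]
    exact 𝔪.sub_mem h10.1 (by simpa using h10.2)

/-- **LAYER-α LEMMA (plus-part freeness at `2` from residual non-triviality of the involution).** `R` local with
`2 ∈ 𝔪_R`, `M` free of rank `2`, `c` an involution with `c m − m ∉ 𝔪M` for some `m`: there is `e` with `{e, c e}` spanning
`M`, `e + c e` torsion-free, and `M^{c=1} = R·(c e + e)` — the planner's `PlusPartFreeAtTwo` (LayerAlpha_sketch.lean)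
verbatim. On the theta habitat (`Δ_E < 0`) this replaces the projector `(1+c)/2` of Vatsal's decomposition by `1 + c`.
[cite: Vatsal1999, §1 and Thm. (1.10)] -/
theorem plusPartFreeAtTwo :
    ∀ (R : Type) [CommRing R] [IsLocalRing R],
    (2 : R) ∈ IsLocalRing.maximalIdeal R →
    ∀ (M : Type) [AddCommGroup M] [Module R M] [Module.Free R M] [Module.Finite R M],
      Module.finrank R M = 2 →
      ∀ (c : M →ₗ[R] M), c ∘ₗ c = LinearMap.id →
        (∃ m : M, c m - m ∉ (IsLocalRing.maximalIdeal R) • (⊤ : Submodule R M)) →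
        ∃ e : M,
          (∀ m : M, c m = m ↔ m ∈ Submodule.span R {c e + e}) ∧
          (∀ r : R, r • (c e + e) = 0 → r = 0) ∧
          Submodule.span R {e, c e} = ⊤ := by
  intro R _ _ h2 M _ _ _ _ hrank c hc hm
  obtain ⟨e, he⟩ := hm
  refine ⟨e, ?_⟩
  set b : Module.Basis (Fin 2) R M := Module.finBasisOfFinrankEq R M hrank with hb
  set w := c e with hw
  have hcw : c w = e := by
    have := LinearMap.congr_fun hc e
    simpa using this
  obtain ⟨d, hd⟩ := isUnit_det_of_involution h2 b c hc he
  -- notation for coordinates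
  set e0 := b.repr e 0
  set e1 := b.repr e 1
  set w0 := b.repr w 0
  set w1 := b.repr w 1
  -- linear independence of `{e, w}` (Cramer)
  have indep : ∀ s t : R, s • e + t • w = 0 → s = 0 ∧ t = 0 := by
    intro s t hst
    have h0 : s * e0 + t * w0 = 0 := by
      have := congrArg (fun x => b.repr x 0) hst
      simpa using this
    have h1 : s * e1 + t * w1 = 0 := by
      have := congrArg (fun x => b.repr x 1) hst
      simpa using this
    have hs : s * (d : R) = 0 := by rw [hd]; linear_combination w1 * h0 - w0 * h1
    have ht : t * (d : R) = 0 := by rw [hd]; linear_combination e0 * h1 - e1 * h0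
    exact ⟨by simpa using congrArg (· * (↑d⁻¹ : R)) hs, by simpa using congrArg (· * (↑d⁻¹ : R)) ht⟩
  -- spanning (Cramer)
  have span : ∀ x : M, ∃ s t : R, x = s • e + t • w := by
    intro x
    set x0 := b.repr x 0
    set x1 := b.repr x 1
    refine ⟨(x0 * w1 - x1 * w0) * ↑d⁻¹, (e0 * x1 - e1 * x0) * ↑d⁻¹, b.ext_elem fun i => ?_⟩
    have hdinv : (e0 * w1 - e1 * w0) * (↑d⁻¹ : R) = 1 := by rw [← hd, Units.mul_inv]
    fin_cases i
    · simp only [Fin.zero_eta, map_add, map_smul, Finsupp.coe_add, Finsupp.coe_smul, Pi.add_apply, Pi.smul_apply,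
        smul_eq_mul]
      linear_combination (-x0) * hdinv
    · simp only [Fin.mk_one, map_add, map_smul, Finsupp.coe_add, Finsupp.coe_smul, Pi.add_apply, Pi.smul_apply,
        smul_eq_mul]
      linear_combination (-x1) * hdinv
  refine ⟨fun m => ?_, fun r hr => ?_, ?_⟩
  · obtain ⟨s, t, rfl⟩ := span m
    constructor
    · intro hfix
      rw [map_add, map_smul, map_smul, hcw] at hfix
      -- `(s − t) • e + (t − s) • w = 0`
      have h0 : (t - s) • e + (s - t) • w = 0 := by
        have := sub_eq_zero.mpr hfix
        rw [← this]; simp only [sub_smul]; abel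
      obtain ⟨hts, -⟩ := indep _ _ h0
      have hst : t = s := sub_eq_zero.mp hts
      subst hst
      rw [← smul_add, add_comm]
      exact Submodule.smul_mem _ _ (Submodule.mem_span_singleton_self _)
    · intro hmem
      obtain ⟨r, hr⟩ := Submodule.mem_span_singleton.mp hmem
      rw [← hr, map_smul, map_add, hcw, add_comm]
  · rw [smul_add, add_comm] at hr
    exact (indep r r hr).1
  · rw [eq_top_iff]
    intro x _
    obtain ⟨s, t, rfl⟩ := span x
    exact Submodule.add_mem _ (Submodule.smul_mem _ _ (Submodule.subset_span (by simp)))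
      (Submodule.smul_mem _ _ (Submodule.subset_span (by simp)))

end LayerAlpha

end Summit.BirchSwinnertonDyer.BirchSwinnertonDyer.Theorems.SignedTransportAtTwo

end
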